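import Literature.AlgebraicGeometry.Motives.MixedHodgeExtensionHomTensorClassJacobianW
import HarnessLib

/-!
# The two models of `Ext¹_MHS(A, B)` agree on `Hom(f, g)`, `⊗ C`, `C ⊗`, `Hom(C, −)`, `Hom(−, C)`

Brylinski–Zucker, *An overview of recent advances in Hodge theory*, Prop. 5.22 gives two descriptions of
`Ext¹_MHS(A, B)`: Beilinson's `J⁰_W Hom(A, B) = W₀Hom(A, B)_ℂ/((F⁰ ∩ W₀) + W₀Hom(A, B)_ℚ)` (the tree's
`(hom A B).jacobianW`, classes `Ext.extEquivJacobianWHom`) and the quotient of `W`-preserving `ℂ`-linear maps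
`J⁰W₀Hom(A, B) = Hom^W(A_ℂ, B_ℂ)/(Hom^W_F + Hom^W_ℚ)` (the tree's `JHomW A B`, classes `Ext.clsW`), identified
by `jacobianWHomEquivJHomW A B : [ξ] ↦ [homBaseChange ξ]` (`MixedHodgeExtensionNonSeparatedInternalHom`).
The tree computes the functorial operations on `Ext¹` in BOTH models: `JHomW.precomp/postcomp`,
`JHomW.rTensor`, `JHomW.lTensor`, `JHomW.homLeft`, `JHomW.homRight`, `JHomW.transposeW` on `J⁰W₀Hom`, and
`J⁰_W(Φ) = Φ.jacobianWMap` for the morphisms of internal Homs `Φ = Hom(f, g)`, `rTensorHom`, `lTensorHom`,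
`homPostcomp`, `homPrecomp`, `homTranspose` (`MixedHodgeExtensionHomTensorClassJacobianW`).

This file records that the identification `jacobianWHomEquivJHomW` intertwines them (every class is the
class of an extension, on which both sides compute the same operation):
`J⁰_W(Hom(f, g)) ↔ f^* g_*`, `J⁰_W(· ⊗ 1_C) ↔ JHomW.rTensor`, `J⁰_W(1_C ⊗ ·) ↔ JHomW.lTensor`,
`J⁰_W(f ↦ f ∘ −) ↔ JHomW.homLeft`, `J⁰_W(f ↦ − ∘ f) ↔ −JHomW.homRight` (the transposition `J⁰_W(ᵗ) ↔ transposeW`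
is `jacobianWHomEquivJHomW_jacobianWMap_homTranspose`). All statements proved; no named facts.

## References

* [BrylinskiZucker1998] J.-L. Brylinski, S. Zucker, An overview of recent advances in Hodge theory, Prop. 5.22.
* [Carlson1980] J. A. Carlson, Extensions of mixed Hodge structures (1980), §2(b) Prop. 1, §2(c) Remark (3).
* [Jannsen1990MixedMotives] U. Jannsen, Mixed Motives and Algebraic K-Theory, LNM 1400 (1990), §9 Remark 9.3 a).
* [DeligneHodgeII1971] P. Deligne, Théorie de Hodge II, 1.1.12.
-/

noncomputable section

open scoped TensorProduct

namespace Literature.AlgebraicGeometry.Motives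

namespace MixedHodgeStructure

variable {VA : Type*} [AddCommGroup VA] [Module ℚ VA] [FiniteDimensional ℚ VA]
variable {VB : Type*} [AddCommGroup VB] [Module ℚ VB] [FiniteDimensional ℚ VB]
variable {VC : Type*} [AddCommGroup VC] [Module ℚ VC] [FiniteDimensional ℚ VC]
variable {VA' : Type*} [AddCommGroup VA'] [Module ℚ VA'] [FiniteDimensional ℚ VA']
variable {VB' : Type*} [AddCommGroup VB'] [Module ℚ VB'] [FiniteDimensional ℚ VB']
variable {A : MixedHodgeStructure VA} {B : MixedHodgeStructure VB}
variable {A' : MixedHodgeStructure VA'} {B' : MixedHodgeStructure VB'}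

/-- **`J⁰_W(Hom(f, g)) ↔ f^* g_*`**: `jacobianWHomEquivJHomW (J⁰_W(Hom(f, g)) c) = f^* g_* (jacobianWHomEquivJHomW c)`.
[cite: BrylinskiZucker1998, Prop. 5.22] [cite: Carlson1980, §2(b) Prop. 1] -/
theorem jacobianWHomEquivJHomW_jacobianWMap_homMap (f : Hom A' A) (g : Hom B B') (c : (hom A B).jacobianW) :
    jacobianWHomEquivJHomW A' B' ((Hom.homMap f g).jacobianWMap c) =
      JHomW.precomp B' f (JHomW.postcomp A g (jacobianWHomEquivJHomW A B c)) := by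
  obtain ⟨x, rfl⟩ := Ext.extEquivJacobianWHom.surjective c
  rw [← Ext.extEquivJacobianWHom_pullbackMapW_pushoutMapW, Ext.jacobianWHomEquivJHomW_extEquivJacobianWHom,
    Ext.jacobianWHomEquivJHomW_extEquivJacobianWHom, ← Ext.extEquivJHomW_apply (Ext.pullbackMapW f (Ext.pushoutMapW g x)),
    Ext.extEquivJHomW_pullbackMapW, ← Ext.extEquivJHomW_apply (Ext.pushoutMapW g x), Ext.extEquivJHomW_pushoutMapW]

/-- `J⁰_W(Hom(A, g)) ↔ g_*`. [cite: BrylinskiZucker1998, Prop. 5.22] [cite: Carlson1980, §2(b) Prop. 1] -/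
theorem jacobianWHomEquivJHomW_jacobianWMap_homMap_id_left (g : Hom B B') (c : (hom A B).jacobianW) :
    jacobianWHomEquivJHomW A B' ((Hom.homMap (Hom.id A) g).jacobianWMap c) =
      JHomW.postcomp A g (jacobianWHomEquivJHomW A B c) := by
  rw [jacobianWHomEquivJHomW_jacobianWMap_homMap, JHomW.precomp_id, LinearMap.id_apply]

/-- `J⁰_W(Hom(f, B)) ↔ f^*`. [cite: BrylinskiZucker1998, Prop. 5.22] [cite: Carlson1980, §2(b) Prop. 1] -/
theorem jacobianWHomEquivJHomW_jacobianWMap_homMap_id_right (f : Hom A' A) (c : (hom A B).jacobianW) :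
    jacobianWHomEquivJHomW A' B ((Hom.homMap f (Hom.id B)).jacobianWMap c) =
      JHomW.precomp B f (jacobianWHomEquivJHomW A B c) := by
  rw [jacobianWHomEquivJHomW_jacobianWMap_homMap, JHomW.postcomp_id, LinearMap.id_apply]

variable (C : MixedHodgeStructure VC)

/-- **`J⁰_W(· ⊗ 1_C) ↔ JHomW.rTensor`** (`[φ] ↦ [φ ⊗ 1]`). [cite: BrylinskiZucker1998, Prop. 5.22]
[cite: Jannsen1990MixedMotives, §9 Remark 9.3 a)] -/
theorem jacobianWHomEquivJHomW_jacobianWMap_rTensorHom (c : (hom A B).jacobianW) :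
    jacobianWHomEquivJHomW (tensor A C) (tensor B C) ((rTensorHom A B C).jacobianWMap c) =
      JHomW.rTensor VC C (jacobianWHomEquivJHomW A B c) := by
  obtain ⟨x, rfl⟩ := Ext.extEquivJacobianWHom.surjective c
  rw [← Ext.extEquivJacobianWHom_rTensorMap, Ext.jacobianWHomEquivJHomW_extEquivJacobianWHom,
    Ext.jacobianWHomEquivJHomW_extEquivJacobianWHom, Ext.clsW_rTensorMap]

/-- **`J⁰_W(1_C ⊗ ·) ↔ JHomW.lTensor`.** [cite: BrylinskiZucker1998, Prop. 5.22] [cite: Jannsen1990MixedMotives, §9 Remark 9.3 a)] -/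
theorem jacobianWHomEquivJHomW_jacobianWMap_lTensorHom (c : (hom A B).jacobianW) :
    jacobianWHomEquivJHomW (tensor C A) (tensor C B) ((lTensorHom A B C).jacobianWMap c) =
      JHomW.lTensor C (jacobianWHomEquivJHomW A B c) := by
  obtain ⟨x, rfl⟩ := Ext.extEquivJacobianWHom.surjective c
  rw [← Ext.extEquivJacobianWHom_lTensorMap, Ext.jacobianWHomEquivJHomW_extEquivJacobianWHom,
    Ext.jacobianWHomEquivJHomW_extEquivJacobianWHom, Ext.clsW_lTensorMap]

/-- **`J⁰_W(f ↦ f ∘ −) ↔ JHomW.homLeft C`** (the transported `Hom(C, ·)` on `J⁰W₀Hom`).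
[cite: BrylinskiZucker1998, Prop. 5.22] [cite: DeligneHodgeII1971, 1.1.12] -/
theorem jacobianWHomEquivJHomW_jacobianWMap_homPostcomp (c : (hom A B).jacobianW) :
    jacobianWHomEquivJHomW (hom C A) (hom C B) ((homPostcomp A B C).jacobianWMap c) =
      JHomW.homLeft C (jacobianWHomEquivJHomW A B c) := by
  obtain ⟨x, rfl⟩ := Ext.extEquivJacobianWHom.surjective c
  rw [← Ext.extEquivJacobianWHom_homLeftMap, Ext.jacobianWHomEquivJHomW_extEquivJacobianWHom,
    Ext.jacobianWHomEquivJHomW_extEquivJacobianWHom, Ext.clsW_homLeftMap]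

/-- **`J⁰_W(f ↦ − ∘ f) ↔ −JHomW.homRight C`** (the sign of Carlson's dual class).
[cite: BrylinskiZucker1998, Prop. 5.22] [cite: Carlson1980, §2(c) Remark (3)] -/
theorem jacobianWHomEquivJHomW_jacobianWMap_homPrecomp (c : (hom A B).jacobianW) :
    jacobianWHomEquivJHomW (hom B C) (hom A C) ((homPrecomp A B C).jacobianWMap c) =
      -JHomW.homRight C (jacobianWHomEquivJHomW A B c) := by
  obtain ⟨x, rfl⟩ := Ext.extEquivJacobianWHom.surjective c
  have h : (homPrecomp A B C).jacobianWMap (Ext.extEquivJacobianWHom x) =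
      -Ext.extEquivJacobianWHom (Ext.homRightMap C x) := by
    rw [Ext.extEquivJacobianWHom_homRightMap, neg_neg]
  rw [h, map_neg, Ext.jacobianWHomEquivJHomW_extEquivJacobianWHom, Ext.jacobianWHomEquivJHomW_extEquivJacobianWHom,
    Ext.clsW_homRightMap]

/-- Conversely on `J⁰W₀Hom`: `JHomW.rTensor VC C d = jacobianWHomEquivJHomW (J⁰_W(· ⊗ 1_C) (jacobianWHomEquivJHomW⁻¹ d))`.
[cite: BrylinskiZucker1998, Prop. 5.22] -/
theorem JHomW.rTensor_eq_jacobianWHomEquivJHomW (d : JHomW A B) :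
    JHomW.rTensor VC C d =
      jacobianWHomEquivJHomW (tensor A C) (tensor B C)
        ((rTensorHom A B C).jacobianWMap ((jacobianWHomEquivJHomW A B).symm d)) := by
  rw [jacobianWHomEquivJHomW_jacobianWMap_rTensorHom, LinearEquiv.apply_symm_apply]

/-- Conversely on `J⁰W₀Hom`: `JHomW.homLeft C d = jacobianWHomEquivJHomW (J⁰_W(f ↦ f ∘ −) (jacobianWHomEquivJHomW⁻¹ d))`.
[cite: BrylinskiZucker1998, Prop. 5.22] -/
theorem JHomW.homLeft_eq_jacobianWHomEquivJHomW (d : JHomW A B) :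
    JHomW.homLeft C d =
      jacobianWHomEquivJHomW (hom C A) (hom C B)
        ((homPostcomp A B C).jacobianWMap ((jacobianWHomEquivJHomW A B).symm d)) := by
  rw [jacobianWHomEquivJHomW_jacobianWMap_homPostcomp, LinearEquiv.apply_symm_apply]

/-- Conversely on `J⁰W₀Hom`: `JHomW.homRight C d = −jacobianWHomEquivJHomW (J⁰_W(f ↦ − ∘ f) (jacobianWHomEquivJHomW⁻¹ d))`.
[cite: BrylinskiZucker1998, Prop. 5.22] [cite: Carlson1980, §2(c) Remark (3)] -/
theorem JHomW.homRight_eq_neg_jacobianWHomEquivJHomW (d : JHomW A B) :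
    JHomW.homRight C d =
      -jacobianWHomEquivJHomW (hom B C) (hom A C)
        ((homPrecomp A B C).jacobianWMap ((jacobianWHomEquivJHomW A B).symm d)) := by
  rw [jacobianWHomEquivJHomW_jacobianWMap_homPrecomp, LinearEquiv.apply_symm_apply, neg_neg]

end MixedHodgeStructure

end Literature.AlgebraicGeometry.Motives

end
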